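import Literature.MathematicalPhysics.QuantumLattice.HubbardKuboKishiFSum
import Literature.MathematicalPhysics.QuantumLattice.HubbardKuboKishiGaussianDomination
import Literature.MathematicalPhysics.QuantumLattice.HeisenbergOrderEvenTorusLROProofs
import Literature.MathematicalPhysics.QuantumLattice.HubbardThermalPseudospinIsotropy
import Literature.MathematicalPhysics.QuantumLattice.HubbardHubbardModel
import HarnessLib

/-!
# Kubo–Kishi 1990, Remark 3: no charge-density-wave and no on-site-pairing long-range order at
# any temperature in the half-filled repulsive Hubbard model on a bipartite lattice, in every
# dimension

Topic `MathematicalPhysics/QuantumLattice` (family `hubbard`). K. Kubo, T. Kishi, *Rigorous bounds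
on the susceptibilities of the Hubbard model*, Phys. Rev. B **41** (1990) 4866–4868
[KuboKishi1990] (reprinted in A. Montorsi (ed.), *The Hubbard Model*, World Scientific 1992,
pp. 120–122; read there, reprint p. 123 = PRB p. 4867).

Kubo–Kishi's Theorem 2 bounds the charge susceptibility of the half-filled REPULSIVE model
(`U > 0`, `μ = U/2`) on a bipartite lattice by `U⁻¹` at every wave vector, and their Remark 3 draws
the consequence: "According to (5) and (6) the charge and the on-site pairing susceptibility do not
diverge at a finite temperature. Also by using the Falk–Bruch inequality we can prove the absence
of corresponding long-range order at any temperature. We conclude, therefore, no phase transition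
leading to charge-density wave or on-site Cooper pairing occurs in the half-filled repulsive model
on a bipartite lattice" — in EVERY dimension (abstract: "bounds … which hold in all dimensions …
the absence of corresponding long-range order"); it is not a Mermin–Wagner statement.

The tree already PROVES the quantitative input: `kuboKishi_staggered_charge_sq_le`
(`HubbardKuboKishiFSum.lean`, from the Gaussian-domination theorem
`kuboKishi_charge_gaussianDomination_holds` and the Falk–Bruch transfer) — for any sign pattern `ε`
alternating along the edges of a graph of maximal degree `Δ`,
`⟨D_ε²⟩_β ≤ |Λ|/(βU) + ½ √((|Λ|/U)·4Δ|t||Λ|)`, `D_ε = Σ_x ε_x (n_x - 1)` the staggered charge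
field; and the thermal pseudospin isotropy `⟨D_ε²⟩_β = 2 ⟨η†_1 η_1⟩_β` of the half-filled model
(`hubbardTorus_gibbsState_staggeredCharge_sq_eq_two_mul_pair`, `HubbardThermalPseudospinIsotropy.lean`,
Zhang 1990), which turns the charge bound into a bound on the uniform on-site pair structure factor
`⟨η†_1 η_1⟩ = Σ_{x,y} ⟨Δ†_x Δ_y⟩`. This file states the CONCLUSIONS of Remark 3 in the tree's
long-range-order vocabulary (`HasStaggeredEvenTorusLRO` of `HeisenbergOrder.lean` for the
`(π,…,π)` charge-density wave, `HasTorusLRO` of `LatticeTori.lean` for the uniform pair field, as in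
the Koma–Tasaki `d = 2` statements `koma_tasaki_noLRO` / `HubbardThermalNoStaggeredLRO.lean`, which
are uniform in `U` and in the filling but planar) and proves them:

* `chargeDev x = n_x - 1` — Kubo–Kishi's `δn_α = n_α - ⟨n_α⟩` at half filling (Remark 2:
  `⟨n_{ασ}⟩ = ½`), with `chargeDensityField a = Σ_x a_x • chargeDev x` (`rfl`), and
  `thermalChargeCorr β t U L x y = Re ⟨δn_x δn_y⟩_{β, L}` — the thermal density–density two-point
  function of `hubbardTorusWith d L t U (U/2)` as an `L`-indexed torus family (sites of
  `(ℤ/Lℤ)^d` ↦ orbitals via `FermionTorus.ofTorusSite`, as for `thermalPairCorr`);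
* `re_gibbsState_chargeDensityField_mul` — `Re ⟨D_a D_b⟩ = Σ_{z,w} a_z b_w Re ⟨δn_z δn_w⟩`
  (bilinearity);
* `staggeredSum_thermalChargeCorr_eq` — the staggered double sum
  `Σ_{x,y} (-1)^x (-1)^y Re ⟨δn_x δn_y⟩_{β,L}` IS `Re ⟨D_ε²⟩_{β,L}` for the bipartite sign
  `ε = torusStagger`;
* `not_hasStaggeredEvenTorusLRO_of_abs_staggeredSum_le` — a torus family whose staggered double
  sums are `O(L^d)` along the even sides has no staggered long-range order (the normalised sums are
  `O(L^{-d}) → 0`, `d ≥ 1`);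
* `hubbard_halfFilled_thermal_not_staggeredChargeLRO` — **Kubo–Kishi's Remark 3, CDW half**: for
  every `d ≥ 1`, every hopping `t`, every `U > 0` and every `0 < β < ∞`,
  `¬ HasStaggeredEvenTorusLRO (thermalChargeCorr β t U)`: no `(π, …, π)` charge-density-wave
  long-range order in the half-filled repulsive Hubbard model on `(ℤ/Lℤ)^d` at any temperature,
  with the explicit finite-volume bound `0 ≤ Σ_{x,y} (-1)^{x+y} ⟨δn_x δn_y⟩_{β,L} ≤ (1/(βU) + ½√(8d|t|/U)) L^d`
  (`staggeredSum_thermalChargeCorr_le`);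
* `sum_thermalPairCorr_eq` — `Σ_{x,y} Re ⟨Δ†_x Δ_y⟩_{β,L} = Re ⟨η†_1 η_1⟩_{β,L}` (any `μ`), and
  `sum_thermalPairCorr_halfFilled_le` — at `μ = U/2`, `L` even:
  `Σ_{x,y} Re ⟨Δ†_x Δ_y⟩_{β,L} ≤ ½ (1/(βU) + ½√(8d|t|/U)) L^d` (pseudospin isotropy + the CDW bound);
* `not_hasTorusLRO_of_nonneg_of_even_sum_le` — a torus family with nonnegative double sums that are
  `O(L^d)` along the even sides has no (uniform) long-range order (`liminf ≤ ε` frequently);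
* `hubbard_halfFilled_thermal_not_uniformPairLRO` — **Kubo–Kishi's Remark 3, pairing half**: for
  every `d ≥ 1`, `t`, `U > 0`, `0 < β < ∞`, `¬ HasTorusLRO (thermalPairCorr β t U (U/2))`: no on-site
  (`s`-wave) Cooper-pair long-range order in the half-filled repulsive Hubbard model on `(ℤ/Lℤ)^d` at
  any temperature.

Scope (honest): half filling `μ = U/2` and bipartite (even) tori only, where Kubo–Kishi's Theorem 2
and the `η`-symmetry hold; `U > 0`; no decay rate; nothing here bears on d-wave pairing or on the
doped model. Theorems and two definitions (observables); no named fact, no statement of the tree is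
changed.
HONEST FRAMING (cell pub-hubbard): ladder R1–R4 with certified numbers; no claim on H/H₀.

References: [KuboKishi1990] Theorem 2, eqs. (5), (6), Remarks 2, 3 (PRB 41, p. 4867); H. Falk,
L. W. Bruch, Phys. Rev. 180 (1969) 442; [DLS1978] §1 eq. (4) (the `|Λ|⁻²`-normalised order
parameter); S.-C. Zhang, PRL 65 (1990) 120 [Zhang1990] (pseudospin symmetry); [FriedliVelenik2017]
§3.7.2 Definition 3.27 (long-range order).
-/

noncomputable section

namespace Literature.MathematicalPhysics.QuantumLattice

open Matrix Finset Filter Topology HubbardWave0 Literature.Probability.LatticeModels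
open scoped ComplexOrder

/-! ### A torus family with `O(L^d)` staggered double sums has no staggered long-range order -/

section Staggered

variable {d : ℕ}

/-- If the staggered double sums of a torus family are `O(L^d)` along the even sides,
`|Σ_{x,y ∈ (ℤ/Lℤ)^d} (-1)^x (-1)^y G_L(x,y)| ≤ C L^d` (`L = 2k+2`), then the `L^{-2d}`-normalised
sums are `O(L^{-d}) → 0` (`d ≥ 1`), so their `liminf` is `0` and `¬ HasStaggeredEvenTorusLRO G`
(unfolded by `hasStaggeredEvenTorusLRO_iff_holds`). This is how a volume-order bound on the
`q = (π,…,π)` structure factor excludes long-range order. Dyson–Lieb–Simon (1978) §1, eq. (4)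
(order parameter `|Λ|⁻² Σ_{x,y}`); Kubo–Kishi (1990) Remark 3.
[cite: KuboKishi1990, Remark 3] -/
theorem not_hasStaggeredEvenTorusLRO_of_abs_staggeredSum_le (hd : d ≠ 0)
    {G : (L : ℕ) → TorusSite d L → TorusSite d L → ℝ} {C : ℝ}
    (hG : ∀ k : ℕ, |∑ x : TorusSite d (2 * k + 2), ∑ y : TorusSite d (2 * k + 2),
        (-1 : ℝ) ^ (∑ i, (x i).val) * (-1) ^ (∑ i, (y i).val) * G (2 * k + 2) x y| ≤
        C * ((2 * k + 2 : ℕ) : ℝ) ^ d) :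
    ¬ HasStaggeredEvenTorusLRO G := by
  classical
  rw [hasStaggeredEvenTorusLRO_iff_holds]
  set a : ℕ → ℝ := fun k =>
    (∑ x : TorusSite d (2 * k + 2), ∑ y : TorusSite d (2 * k + 2),
        (-1 : ℝ) ^ (∑ i, (x i).val) * (-1) ^ (∑ i, (y i).val) * G (2 * k + 2) x y) /
      ((2 * k + 2 : ℕ) : ℝ) ^ (2 * d) with ha
  have hL : Tendsto (fun k : ℕ => ((2 * k + 2 : ℕ) : ℝ)) atTop atTop :=
    tendsto_natCast_atTop_atTop.comp
      (Filter.tendsto_atTop_mono (fun k : ℕ => (by omega : k ≤ 2 * k + 2)) tendsto_id)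
  have h2 : Tendsto (fun k : ℕ => C / ((2 * k + 2 : ℕ) : ℝ) ^ d) atTop (𝓝 0) :=
    tendsto_const_nhds.div_atTop ((tendsto_pow_atTop hd).comp hL)
  have hT : Tendsto a atTop (𝓝 0) := by
    refine squeeze_zero_norm (fun k => ?_) h2
    have hL0 : (0 : ℝ) < ((2 * k + 2 : ℕ) : ℝ) := by positivity
    have hLd : (0 : ℝ) < ((2 * k + 2 : ℕ) : ℝ) ^ d := pow_pos hL0 d
    rw [Real.norm_eq_abs, ha]
    dsimp only
    rw [abs_div, abs_of_nonneg (pow_nonneg hL0.le _), two_mul d, pow_add]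
    calc |∑ x : TorusSite d (2 * k + 2), ∑ y : TorusSite d (2 * k + 2),
            (-1 : ℝ) ^ (∑ i, (x i).val) * (-1) ^ (∑ i, (y i).val) * G (2 * k + 2) x y| /
          (((2 * k + 2 : ℕ) : ℝ) ^ d * ((2 * k + 2 : ℕ) : ℝ) ^ d)
        ≤ C * ((2 * k + 2 : ℕ) : ℝ) ^ d / (((2 * k + 2 : ℕ) : ℝ) ^ d * ((2 * k + 2 : ℕ) : ℝ) ^ d) :=
          div_le_div_of_nonneg_right (hG k) (mul_pos hLd hLd).le
      _ = C / ((2 * k + 2 : ℕ) : ℝ) ^ d := by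
          rw [mul_div_mul_right _ _ hLd.ne']
  intro hLRO
  change 0 < liminf a atTop at hLRO
  rw [hT.liminf_eq] at hLRO
  exact lt_irrefl 0 hLRO

end Staggered

/-! ### The on-site charge deviation and bilinearity of `⟨D_a D_b⟩` -/

section Fields

variable {Λ : Type*} [LinearOrder Λ] [Fintype Λ]

/-- The on-site charge deviation `δn_x = n_{x↑} + n_{x↓} - 1 = n_x - 1`; at half filling
`⟨n_{xσ}⟩ = ½` (Kubo–Kishi Remark 2), so `δn_x = n_x - ⟨n_x⟩`, and the charge field is
`D_a = Σ_x a_x δn_x` (`chargeDensityField_eq_sum_smul_chargeDev`). Kubo–Kishi (1990), Theorem 2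
and Remark 2. [cite: KuboKishi1990, Theorem 2 and Remark 2] -/
def chargeDev (x : Λ) : Matrix (Finset (Orb Λ)) (Finset (Orb Λ)) ℂ :=
  numberOp x 0 + numberOp x 1 - 1

/-- `D_a = Σ_x a_x δn_x` (definitional). Kubo–Kishi (1990), Theorem 2. [cite: KuboKishi1990, Theorem 2] -/
theorem chargeDensityField_eq_sum_smul_chargeDev (a : Λ → ℝ) :
    chargeDensityField a = ∑ x : Λ, (a x : ℂ) • chargeDev x :=
  rfl

/-- `δn_x` is Hermitian. Kubo–Kishi (1990), Theorem 2. [cite: KuboKishi1990, Theorem 2] -/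
theorem isHermitian_chargeDev (x : Λ) : (chargeDev x).IsHermitian := by
  have hn : ∀ τ : Fin 2, (numberOp x τ)ᴴ = numberOp x τ := fun τ =>
    (numberAt_isHermitian (orb x τ)).eq
  unfold chargeDev Matrix.IsHermitian
  rw [conjTranspose_sub, conjTranspose_add, hn, hn, conjTranspose_one]

/-- `Re ⟨D_a D_b⟩_β = Σ_{z,w} a_z b_w Re ⟨δn_z δn_w⟩_β` for the charge fields `D_a = Σ_z a_z δn_z`
and any Hamiltonian (bilinearity of the Gibbs state: the structure factor is a double sum of
two-point functions; stated for an arbitrary `DecidableEq` instance on the orbital sets so that it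
rewrites in every lattice context). Kubo–Kishi (1990), eq. (5) with `δn_q` the Fourier transform
of `δn_α`. [cite: KuboKishi1990, Theorem 2, eq. (5)] -/
theorem re_gibbsState_chargeDensityField_mul [DecidableEq (Finset (Orb Λ))] (β : ℝ)
    (H : Matrix (Finset (Orb Λ)) (Finset (Orb Λ)) ℂ) (a b : Λ → ℝ) :
    (gibbsState β H (chargeDensityField a * chargeDensityField b)).re =
      ∑ z : Λ, ∑ w : Λ, a z * b w * (gibbsState β H (chargeDev z * chargeDev w)).re := by
  rw [chargeDensityField_eq_sum_smul_chargeDev, chargeDensityField_eq_sum_smul_chargeDev,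
    Finset.sum_mul_sum, map_sum, Complex.re_sum]
  refine sum_congr rfl fun z _ => ?_
  rw [map_sum, Complex.re_sum]
  refine sum_congr rfl fun w _ => ?_
  rw [Matrix.smul_mul, Matrix.mul_smul, smul_smul, map_smul, smul_eq_mul, ← Complex.ofReal_mul,
    Complex.re_ofReal_mul]

/-- `Re ⟨D_a D_a⟩_β ≥ 0` for a Hermitian Hamiltonian (`D_a D_a = D_aᴴ D_a ≥ 0` and the Gibbs state
is positive). [folklore] -/
private theorem re_gibbsState_chargeDensityField_sq_nonneg [DecidableEq (Finset (Orb Λ))] (β : ℝ)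
    {H : Matrix (Finset (Orb Λ)) (Finset (Orb Λ)) ℂ} (hH : H.IsHermitian) (a : Λ → ℝ) :
    0 ≤ (gibbsState β H (chargeDensityField a * chargeDensityField a)).re := by
  have hpsd : (chargeDensityField a * chargeDensityField a).PosSemidef := by
    have h := posSemidef_conjTranspose_mul_self (chargeDensityField a)
    rwa [(isHermitian_chargeDensityField a).eq] at h
  exact (Complex.nonneg_iff.mp (gibbsState_nonneg_of_posSemidef β hH hpsd)).1

end Fields

/-! ### The thermal density–density two-point function on the torus at half filling -/

section Torus

variable {d L : ℕ}

/-- The thermal density–density two-point function of the HALF-FILLED grand-canonical Hubbard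
model on the torus `(ℤ/Lℤ)^d`, `G_L(x, y) = Re ⟨δn_x δn_y⟩_{β, L}`, `δn_x = n_x - 1` (Gibbs state of
`hubbardTorusWith d L t U (U/2)`, i.e. `μ = U/2`; orbitals on the fermionic torus via
`FermionTorus.ofTorusSite`), as an `L`-indexed family in the format of `HasStaggeredEvenTorusLRO`;
its staggered (`q = (π,…,π)`) structure factor is the charge-density-wave order parameter.
**Junk value** `0` at `L = 0`. Kubo–Kishi (1990), Theorem 2, eq. (5).
[cite: KuboKishi1990, Theorem 2, eq. (5)] -/
def thermalChargeCorr (β t U : ℝ) : (L : ℕ) → TorusSite d L → TorusSite d L → ℝ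
  | 0, _, _ => 0
  | L + 1, x, y =>
    ((hubbardTorusWith d (L + 1) t U (U / 2)).thermalCorr β
      (chargeDev (FermionTorus.ofTorusSite x)) (chargeDev (FermionTorus.ofTorusSite y))).re

/-- `thermalChargeCorr` at positive side, unfolded. Kubo–Kishi (1990), Theorem 2, eq. (5).
[cite: KuboKishi1990, Theorem 2, eq. (5)] -/
@[simp] theorem thermalChargeCorr_succ (β t U : ℝ) (L : ℕ) (x y : TorusSite d (L + 1)) :
    thermalChargeCorr β t U (L + 1) x y =
      ((hubbardTorusWith d (L + 1) t U (U / 2)).thermalCorr β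
        (chargeDev (FermionTorus.ofTorusSite x)) (chargeDev (FermionTorus.ofTorusSite y))).re :=
  rfl

/-- The bipartite sign of the fermionic torus at a canonical representative is the Néel sign of
`HasStaggeredEvenTorusLRO`: `ε_{ofTorusSite x} = (-1)^{Σᵢ val xᵢ}` (both computed on
representatives in `{0,…,L-1}`; `equivTorusSite.symm = ofTorusSite`). [folklore] -/
private theorem cast_torusStagger_symm_apply [NeZero L] (x : TorusSite d L) :
    ((torusStagger ((FermionTorus.equivTorusSite (d := d) (L := L)).symm x) : ℤ) : ℝ) =
      (-1 : ℝ) ^ (∑ i, (x i).val) := by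
  -- `torusStagger` elaborates to the power operation `Int.instUnitsPow` of Mathlib's
  -- `IntUnitsPower` (definitionally the monoid power); `equivTorusSite.symm = ofTorusSite` reads
  -- off the canonical representatives
  have h : torusStagger ((FermionTorus.equivTorusSite (d := d) (L := L)).symm x) =
      NPow.npow (∑ i, (x i).val) (-1 : ℤˣ) := rfl
  rw [h, npow_eq_pow, Units.val_pow_eq_pow_val, Units.val_neg, Units.val_one, Int.cast_pow,
    Int.cast_neg, Int.cast_one]

/-- **The staggered double sum is the staggered charge fluctuation**: for `L ≥ 1`,
`Σ_{x,y ∈ (ℤ/Lℤ)^d} (-1)^x (-1)^y Re ⟨δn_x δn_y⟩_{β,L} = Re ⟨D_ε D_ε⟩_{β,L}` with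
`D_ε = Σ_z ε_z δn_z`, `ε = torusStagger` the bipartite sign (sites of `(ℤ/Lℤ)^d` and of the
fermionic torus compared through `FermionTorus.equivTorusSite`). Kubo–Kishi (1990), eq. (5)
(`(δn_q, δn_{-q})` at `q = (π,…,π)`). [cite: KuboKishi1990, Theorem 2, eq. (5)] -/
theorem staggeredSum_thermalChargeCorr_eq (β t U : ℝ) (L : ℕ) [NeZero L] :
    (∑ x : TorusSite d L, ∑ y : TorusSite d L,
        (-1 : ℝ) ^ (∑ i, (x i).val) * (-1) ^ (∑ i, (y i).val) * thermalChargeCorr β t U L x y) =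
      (gibbsState β (hubbardTorusWith d L t U (U / 2))
        (chargeDensityField (fun z => ((torusStagger z : ℤ) : ℝ)) *
          chargeDensityField fun z => ((torusStagger z : ℤ) : ℝ))).re := by
  obtain ⟨n, rfl⟩ : ∃ n, L = n + 1 := Nat.exists_eq_succ_of_ne_zero (NeZero.ne L)
  rw [re_gibbsState_chargeDensityField_mul]
  refine Fintype.sum_equiv (FermionTorus.equivTorusSite (d := d) (L := n + 1)).symm _ _ fun x => ?_
  refine Fintype.sum_equiv (FermionTorus.equivTorusSite (d := d) (L := n + 1)).symm _ _ fun y => ?_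
  rw [cast_torusStagger_symm_apply, cast_torusStagger_symm_apply, thermalChargeCorr_succ]
  rfl

/-- Every site of the torus `(ℤ/Lℤ)^d` has at most `2d` neighbours (`x ± eᵢ`) (private copy of
`card_filter_fermionTorusGraph_adj_le` of `HubbardLSMFillingProofs`, not imported here).
[folklore] -/
private theorem card_filter_fermionTorusGraph_adj_le' [NeZero L] (u : FermionTorus d L) :
    (Finset.univ.filter fun v => (fermionTorusGraph d L).Adj u v).card ≤ 2 * d := by
  classical
  set S₁ : Finset (FermionTorus d L) := Finset.univ.image fun i : Fin d =>
    FermionTorus.ofTorusSite (FermionTorus.toTorusSite u + Pi.single i (1 : ZMod L))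
  set S₂ : Finset (FermionTorus d L) := Finset.univ.image fun i : Fin d =>
    FermionTorus.ofTorusSite (FermionTorus.toTorusSite u - Pi.single i (1 : ZMod L))
  have hsub : (Finset.univ.filter fun v => (fermionTorusGraph d L).Adj u v) ⊆ S₁ ∪ S₂ := by
    intro v hv
    rw [Finset.mem_filter] at hv
    obtain ⟨-, hv⟩ := hv
    rw [fermionTorusGraph_adj, torusGraph_adj_iff] at hv
    obtain ⟨-, ⟨i, hi⟩ | ⟨i, hi⟩⟩ := hv
    · refine Finset.mem_union_left _ (Finset.mem_image.2 ⟨i, Finset.mem_univ _, ?_⟩)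
      rw [← hi, FermionTorus.ofTorusSite_toTorusSite]
    · refine Finset.mem_union_right _ (Finset.mem_image.2 ⟨i, Finset.mem_univ _, ?_⟩)
      rw [hi, add_sub_cancel_right, FermionTorus.ofTorusSite_toTorusSite]
  calc (Finset.univ.filter fun v => (fermionTorusGraph d L).Adj u v).card
      ≤ (S₁ ∪ S₂).card := Finset.card_le_card hsub
    _ ≤ S₁.card + S₂.card := Finset.card_union_le _ _
    _ ≤ d + d := add_le_add (Finset.card_image_le.trans (by simp))
        (Finset.card_image_le.trans (by simp))
    _ = 2 * d := by ring

/-- The fermionic torus has `L^d` sites (private copy of `card_fermionTorus` of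
`HubbardHubbardModelEtaPairingProofs`, not imported here). [folklore] -/
private theorem card_fermionTorus'' : Fintype.card (FermionTorus d L) = L ^ d := by
  change Fintype.card (Fin d → Fin L) = L ^ d
  rw [Fintype.card_fun, Fintype.card_fin, Fintype.card_fin]

/-- **Finite-volume CDW bound at half filling** (Kubo–Kishi Theorem 2 + Falk–Bruch, on the torus):
for `U > 0`, `μ = U/2`, `β > 0`, every `d` and every EVEN side `L ≥ 2`,
`0 ≤ Σ_{x,y ∈ (ℤ/Lℤ)^d} (-1)^x (-1)^y Re ⟨δn_x δn_y⟩_{β,L} ≤ (1/(βU) + ½ √(4·(2d)·|t|/U)) · L^d`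
— the staggered charge structure factor is of the order of the volume, not of its square
(`kuboKishi_staggered_charge_sq_le` with `ε = torusStagger`, `Δ = 2d`, `|Λ| = L^d`; the lower
bound is positivity of the Gibbs state on `D_ε D_ε = D_εᴴ D_ε`).
[cite: KuboKishi1990, Theorem 2, eq. (5) and Remark 3] -/
theorem staggeredSum_thermalChargeCorr_le (t : ℝ) {U β : ℝ} (hU : 0 < U) (hβ : 0 < β) (L : ℕ)
    [NeZero L] (hL : Even L) :
    0 ≤ ∑ x : TorusSite d L, ∑ y : TorusSite d L,
        (-1 : ℝ) ^ (∑ i, (x i).val) * (-1) ^ (∑ i, (y i).val) * thermalChargeCorr β t U L x y ∧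
    (∑ x : TorusSite d L, ∑ y : TorusSite d L,
        (-1 : ℝ) ^ (∑ i, (x i).val) * (-1) ^ (∑ i, (y i).val) * thermalChargeCorr β t U L x y) ≤
      (1 / U / β + 1 / 2 * Real.sqrt (4 * (2 * d : ℕ) * |t| / U)) * (L : ℝ) ^ d := by
  rw [staggeredSum_thermalChargeCorr_eq]
  have hHG : hubbardTorusWith d L t U (U / 2) = hamiltonianWith (fermionTorusGraph d L) t U (U / 2) :=
    rfl
  refine ⟨re_gibbsState_chargeDensityField_sq_nonneg β
    (isHermitian_hamiltonianWith (fermionTorusGraph d L) t U (U / 2)) _, ?_⟩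
  -- Kubo–Kishi Theorem 2 + Falk–Bruch with the bipartite sign `torusStagger`, degree `≤ 2d`
  have hKK : (gibbsState β (hubbardTorusWith d L t U (U / 2))
      (chargeDensityField (fun z => ((torusStagger z : ℤ) : ℝ)) *
        chargeDensityField fun z => ((torusStagger z : ℤ) : ℝ))).re ≤
      (Fintype.card (FermionTorus d L) : ℝ) / U / β +
        1 / 2 * Real.sqrt ((Fintype.card (FermionTorus d L) : ℝ) / U *
          (|t| * (4 * (2 * d : ℕ) * Fintype.card (FermionTorus d L)))) := by
    rw [hHG]
    -- `convert`: the torus statement carries the structural `DecidableEq` instance on the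
    -- orbitals, the generic lemma the one derived from the linear order (`Subsingleton.elim`)
    convert kuboKishi_staggered_charge_sq_le (fermionTorusGraph d L)
      kuboKishi_charge_gaussianDomination_holds torusStagger
      (fun _ _ h => torusStagger_eq_neg_of_adj_holds hL h)
      (fun x => card_filter_fermionTorusGraph_adj_le' x) (t := t) hU hβ
  refine hKK.trans (le_of_eq ?_)
  rw [card_fermionTorus'', Nat.cast_pow]
  set N : ℝ := (L : ℝ) ^ d with hNdef
  have hN0 : 0 ≤ N := pow_nonneg (Nat.cast_nonneg _) d
  have hin : N / U * (|t| * (4 * ((2 * d : ℕ) : ℝ) * N)) =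
      4 * ((2 * d : ℕ) : ℝ) * |t| / U * N ^ 2 := by
    ring
  rw [hin, Real.sqrt_mul' _ (sq_nonneg N), Real.sqrt_sq hN0]
  ring

/-- **Kubo–Kishi 1990, Remark 3 (charge-density-wave half): no CDW long-range order at any
temperature in the half-filled repulsive Hubbard model on a bipartite lattice, in every
dimension.** For every `d ≥ 1`, every hopping `t`, every `U > 0` and every `0 < β < ∞`, the thermal
density–density two-point function `Re ⟨δn_x δn_y⟩_{β,L}` of `hubbardTorusWith d L t U (U/2)` has
no staggered (`q = (π,…,π)`) long-range order along the even tori `(ℤ/Lℤ)^d`: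
`¬ HasStaggeredEvenTorusLRO (thermalChargeCorr β t U)` — the `L^{-2d}`-normalised staggered charge
structure factor is `≤ (1/(βU) + ½√(8d|t|/U)) L^{-d} → 0` (`staggeredSum_thermalChargeCorr_le`).
An interaction-dependent, dimension-independent exclusion (Gaussian domination in spin space +
Falk–Bruch), in contrast with the `U`-uniform but planar Koma–Tasaki bounds. "By using the
Falk–Bruch inequality we can prove the absence of corresponding long-range order at any
temperature … no phase transition leading to charge-density wave … occurs in the half-filled
repulsive model on a bipartite lattice." [cite: KuboKishi1990, Remark 3 (PRB 41, p. 4867); Theorem 2, eq. (5)] -/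
theorem hubbard_halfFilled_thermal_not_staggeredChargeLRO (hd : d ≠ 0) (t : ℝ) {U β : ℝ}
    (hU : 0 < U) (hβ : 0 < β) :
    ¬ HasStaggeredEvenTorusLRO (thermalChargeCorr (d := d) β t U) :=
  not_hasStaggeredEvenTorusLRO_of_abs_staggeredSum_le hd
    (C := 1 / U / β + 1 / 2 * Real.sqrt (4 * (2 * d : ℕ) * |t| / U)) fun k => by
    obtain ⟨h0, hle⟩ :=
      staggeredSum_thermalChargeCorr_le (d := d) t hU hβ (2 * k + 2) ⟨k + 1, by ring⟩
    rwa [abs_of_nonneg h0]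

end Torus

/-! ### The on-site-pairing half of Remark 3: no uniform `s`-wave pair long-range order -/

section Pairing

variable {d : ℕ}

/-- If the (unsigned) double sums of a torus family are NONNEGATIVE for every side and `O(L^d)`
along the EVEN sides, `Σ_{x,y ∈ (ℤ/Lℤ)^d} G_L(x,y) ≤ C L^d` (`L = 2k+2`), then `¬ HasTorusLRO G`: the
`L^{-2d}`-normalised sums are `≥ 0` and `≤ C L^{-d}` frequently, so their `liminf` is `≤ ε` for every
`ε > 0` (`Filter.liminf_le_of_frequently_le`), hence not positive (unfolded by `hasTorusLRO_iff_holds`).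
The parity restriction is the one of Kubo–Kishi's Theorem 2 (bipartite tori have even side).
Friedli–Velenik (2017) §3.7.2, Definition 3.27; Kubo–Kishi (1990) Remark 3.
[cite: KuboKishi1990, Remark 3] -/
theorem not_hasTorusLRO_of_nonneg_of_even_sum_le (hd : d ≠ 0)
    {G : (L : ℕ) → TorusSite d L → TorusSite d L → ℝ} {C : ℝ}
    (h0 : ∀ (L : ℕ) [NeZero L], 0 ≤ ∑ x : TorusSite d L, ∑ y : TorusSite d L, G L x y)
    (hle : ∀ k : ℕ, (∑ x : TorusSite d (2 * k + 2), ∑ y : TorusSite d (2 * k + 2), G (2 * k + 2) x y) ≤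
        C * ((2 * k + 2 : ℕ) : ℝ) ^ d) :
    ¬ HasTorusLRO G := by
  classical
  rw [hasTorusLRO_iff_holds]
  set a : ℕ → ℝ := fun L =>
    (∑ x : TorusSite d (L + 1), ∑ y : TorusSite d (L + 1), G (L + 1) x y) /
      ((L + 1 : ℕ) : ℝ) ^ (2 * d) with ha
  have ha0 : ∀ L, 0 ≤ a L := fun L => div_nonneg (h0 (L + 1)) (pow_nonneg (Nat.cast_nonneg _) _)
  -- along the even sides `L + 1 = 2k + 2` the normalised sum is `≤ C / L^d`
  have hak : ∀ k, a (2 * k + 1) ≤ C / ((2 * k + 2 : ℕ) : ℝ) ^ d := by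
    intro k
    have hL0 : (0 : ℝ) < ((2 * k + 2 : ℕ) : ℝ) := by positivity
    have hLd : (0 : ℝ) < ((2 * k + 2 : ℕ) : ℝ) ^ d := pow_pos hL0 d
    have hk : a (2 * k + 1) = (∑ x : TorusSite d (2 * k + 2), ∑ y : TorusSite d (2 * k + 2),
        G (2 * k + 2) x y) / (((2 * k + 2 : ℕ) : ℝ) ^ d * ((2 * k + 2 : ℕ) : ℝ) ^ d) := by
      rw [← pow_add, ← two_mul]
    rw [hk]
    calc (∑ x : TorusSite d (2 * k + 2), ∑ y : TorusSite d (2 * k + 2), G (2 * k + 2) x y) /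
          (((2 * k + 2 : ℕ) : ℝ) ^ d * ((2 * k + 2 : ℕ) : ℝ) ^ d)
        ≤ C * ((2 * k + 2 : ℕ) : ℝ) ^ d / (((2 * k + 2 : ℕ) : ℝ) ^ d * ((2 * k + 2 : ℕ) : ℝ) ^ d) :=
          div_le_div_of_nonneg_right (hle k) (mul_pos hLd hLd).le
      _ = C / ((2 * k + 2 : ℕ) : ℝ) ^ d := by rw [mul_div_mul_right _ _ hLd.ne']
  have hL : Tendsto (fun k : ℕ => ((2 * k + 2 : ℕ) : ℝ)) atTop atTop :=
    tendsto_natCast_atTop_atTop.comp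
      (Filter.tendsto_atTop_mono (fun k : ℕ => (by omega : k ≤ 2 * k + 2)) tendsto_id)
  have h2 : Tendsto (fun k : ℕ => C / ((2 * k + 2 : ℕ) : ℝ) ^ d) atTop (𝓝 0) :=
    tendsto_const_nhds.div_atTop ((tendsto_pow_atTop hd).comp hL)
  have hfreq : ∀ ε : ℝ, 0 < ε → ∃ᶠ L in atTop, a L ≤ ε := by
    intro ε hε
    obtain ⟨K, hK⟩ := eventually_atTop.1 (h2.eventually (eventually_lt_nhds hε))
    rw [Filter.frequently_atTop]
    intro N
    exact ⟨2 * max K N + 1, by omega, (hak _).trans (hK _ (le_max_left _ _)).le⟩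
  have hbdd : IsBoundedUnder (· ≥ ·) atTop a := Filter.isBoundedUnder_of ⟨0, fun L => ha0 L⟩
  intro hLRO
  change 0 < liminf a atTop at hLRO
  have h := Filter.liminf_le_of_frequently_le (hfreq (liminf a atTop / 2) (half_pos hLRO)) hbdd
  linarith

/-- **The double sum of the pair family is the uniform pair structure factor**: for `L ≥ 1` and any
`μ`, `Σ_{x,y ∈ (ℤ/Lℤ)^d} Re ⟨Δ†_x Δ_y⟩_{β,L} = Re ⟨η†_1 η_1⟩_{β,L}` (`η†_1 η_1 = B†B = Σ_{x,y} Δ†_x Δ_y`,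
`etaRaise_one_mul_etaLower_one`; `B = Σ_x c_{x↓}c_{x↑}` the uniform on-site pair field).
Kubo–Kishi (1990), eq. (6) at `q = 0`; Yang (1989), eq. (4). [cite: KuboKishi1990, Theorem 2, eq. (6)] -/
theorem sum_thermalPairCorr_eq (β t U μ : ℝ) (L : ℕ) [NeZero L] :
    (∑ x : TorusSite d L, ∑ y : TorusSite d L, thermalPairCorr β t U μ L x y) =
      (gibbsState β (hubbardTorusWith d L t U μ)
        (etaRaise (fun _ : FermionTorus d L => (1 : ℤˣ)) * etaLower fun _ => 1)).re := by
  obtain ⟨n, rfl⟩ : ∃ n, L = n + 1 := Nat.exists_eq_succ_of_ne_zero (NeZero.ne L)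
  rw [etaRaise_one_mul_etaLower_one, map_sum, Complex.re_sum]
  refine Fintype.sum_equiv (FermionTorus.equivTorusSite (d := d) (L := n + 1)).symm _ _ fun x => ?_
  rw [map_sum, Complex.re_sum]
  refine Fintype.sum_equiv (FermionTorus.equivTorusSite (d := d) (L := n + 1)).symm _ _ fun y => ?_
  rw [thermalPairCorr_succ, Matrix.thermalCorr, onSitePair_conjTranspose]
  rfl

/-- **Finite-volume bound on the uniform on-site pair structure factor at half filling**: for `U > 0`,
`μ = U/2`, `β > 0`, every `d` and every even side `L`,
`0 ≤ Σ_{x,y ∈ (ℤ/Lℤ)^d} Re ⟨Δ†_x Δ_y⟩_{β,L} ≤ ½ (1/(βU) + ½ √(4·(2d)·|t|/U)) · L^d` — by the thermal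
pseudospin isotropy `⟨F_ε²⟩_β = 2 ⟨η†_1 η_1⟩_β` of the half-filled model
(`hubbardTorus_gibbsState_staggeredCharge_sq_eq_two_mul_pair`, Zhang 1990) and the CDW bound
`staggeredSum_thermalChargeCorr_le`; positivity from `η†_1 η_1 = η†_1 (η†_1)ᴴ ≥ 0`.
[cite: KuboKishi1990, Theorem 2, eq. (6) and Remark 3] [cite: Zhang1990] -/
theorem sum_thermalPairCorr_halfFilled_le (t : ℝ) {U β : ℝ} (hU : 0 < U) (hβ : 0 < β) (L : ℕ)
    [NeZero L] (hL : Even L) :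
    (∑ x : TorusSite d L, ∑ y : TorusSite d L, thermalPairCorr β t U (U / 2) L x y) ≤
      1 / 2 * ((1 / U / β + 1 / 2 * Real.sqrt (4 * (2 * d : ℕ) * |t| / U)) * (L : ℝ) ^ d) := by
  have h2 : ∀ z : ℂ, ((2 : ℂ) * z).re = 2 * z.re := fun z => by simp [Complex.mul_re]
  have hiso := congrArg Complex.re
    (hubbardTorus_gibbsState_staggeredCharge_sq_eq_two_mul_pair (d := d) (L := L) hL t U β)
  rw [h2, ← staggeredSum_thermalChargeCorr_eq] at hiso
  rw [sum_thermalPairCorr_eq]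
  have hle := (staggeredSum_thermalChargeCorr_le (d := d) t hU hβ L hL).2
  linarith

/-- The uniform pair structure factor is nonnegative at every side and filling:
`0 ≤ Σ_{x,y} Re ⟨Δ†_x Δ_y⟩_{β,L}` (`η†_1 η_1 = η†_1 (η†_1)ᴴ` is positive semidefinite and the Gibbs state
of the Hermitian `H(t,U) - μN` is positive). [folklore] -/
private theorem sum_thermalPairCorr_nonneg (β t U μ : ℝ) (L : ℕ) [NeZero L] :
    0 ≤ ∑ x : TorusSite d L, ∑ y : TorusSite d L, thermalPairCorr β t U μ L x y := by
  rw [sum_thermalPairCorr_eq]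
  have hpsd : (etaRaise (fun _ : FermionTorus d L => (1 : ℤˣ)) * etaLower fun _ => 1).PosSemidef :=
    posSemidef_self_mul_conjTranspose _
  exact (Complex.nonneg_iff.mp (gibbsState_nonneg_of_posSemidef β
    (isHermitian_hamiltonianWith (fermionTorusGraph d L) t U μ) hpsd)).1

/-- **Kubo–Kishi 1990, Remark 3 (on-site-pairing half): no on-site (`s`-wave, `q = 0`) pair
long-range order at any temperature in the half-filled repulsive Hubbard model on a bipartite
lattice, in every dimension.** For every `d ≥ 1`, every hopping `t`, every `U > 0` and every
`0 < β < ∞`, the thermal on-site pair two-point function `Re ⟨c†_{x↑}c†_{x↓} c_{y↓}c_{y↑}⟩_{β,L}` of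
`hubbardTorusWith d L t U (U/2)` has no (uniform) long-range order along the tori `(ℤ/Lℤ)^d`:
`¬ HasTorusLRO (thermalPairCorr β t U (U/2))` — "no phase transition leading to … on-site Cooper
pairing occurs in the half-filled repulsive model on a bipartite lattice". Interaction-dependent and
dimension-independent, at half filling only; compare the planar but filling- and `U`-uniform
Koma–Tasaki exclusion `koma_tasaki_noLRO` (`d = 2`). Obtained from the CDW half by the thermal
pseudospin isotropy (Zhang 1990; tree `HubbardThermalPseudospinIsotropy`).
[cite: KuboKishi1990, Remark 3 (PRB 41, p. 4867); Theorem 2, eq. (6)] [cite: Zhang1990] -/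
theorem hubbard_halfFilled_thermal_not_uniformPairLRO (hd : d ≠ 0) (t : ℝ) {U β : ℝ} (hU : 0 < U)
    (hβ : 0 < β) :
    ¬ HasTorusLRO (thermalPairCorr (d := d) β t U (U / 2)) :=
  not_hasTorusLRO_of_nonneg_of_even_sum_le hd
    (C := 1 / 2 * (1 / U / β + 1 / 2 * Real.sqrt (4 * (2 * d : ℕ) * |t| / U)))
    (fun L _ => sum_thermalPairCorr_nonneg (d := d) β t U (U / 2) L) fun k => by
    rw [mul_assoc]
    exact sum_thermalPairCorr_halfFilled_le (d := d) t hU hβ (2 * k + 2) ⟨k + 1, by ring⟩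

end Pairing

end Literature.MathematicalPhysics.QuantumLattice
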